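import Summits.CriticalPhenomena.SAWScalingLimit.Theses.SAWDefectDecoherence
import Summits.CriticalPhenomena.SAWScalingLimit.Theorems.MassRatio.Negative.Tools
import Summits.CriticalPhenomena.SAWScalingLimit.Theorems.SAWDefectDecoherenceMassRatioRenewalDefs

/-!
# Objects of the line `flat-root-arc-swap` for the crux `SAWDefectDecoherence.MassRatio`
(stmt-CriticalPhenomena-8550; lead prover, crux protocol; skeleton
`Summits/CriticalPhenomena/SAWScalingLimit/Cruxes/MassRatio/Lines/flat_root_arc_swap.lean`)

The crux `MassRatio` compares, from the WILD boundary root `a_δ`, the normalised bulk mass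
`M_K(a_δ) = δ² Σ_{e ∈ K} Z_δ(a_δ → e)` with the boundary POINT mass `Z_δ(a_δ → b_δ)` at the cut
`δ^{-3/4}` (`Z = F_{x_c, σ = 0}`, a sum of nonnegative reals). The line SWAPS THE ROOT onto the flat
lattice piece at `b` and AVERAGES it over the far arc
`S_δ = {e ∈ ∂Λ_δ : ρ/4 ≤ |δ·mid e − b| ≤ ρ/2}` (door edges of the flat zigzag piece): summing the
cross-ratio inequality `Z(a→K)·Z(b→a') ≤ Cδ^{-ε} Z(a→b)·Z(a'→K)` over `a' ∈ S_δ` (`RootSwapArc ε`)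
removes the wild root; what is left (`ArcMassRatio c`) is arc-rooted bulk mass against the far-arc
arrival mass from the TAME root `b_δ` inside the lattice half-disc `H_δ = Λ_δ ∩ B(b, 3ρ/4)`.

This file only DEFINES the objects the line's registered stubs and its glue speak about, so that the
stub files under `Theorems/` and the glue share one vocabulary — no statement of the line is asserted:

* `Frame`, `swapArc`, `massK`, `halfDisc` — the crux's hypothesis frame (verbatim, curried order),
  the swap arc, the normalised `K`-mass, the lattice half-disc; the spin-`0` mass is the EXISTING
  `Renewal.Z Λ r z = ‖F_{Λ,r,x_c,0}(z)‖` of `…MassRatioRenewalDefs` (reused, not re-declared);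
* the PREDICATES in the exponent: `MassRatioAt c` (the crux is `MassRatioAt (3/4)`), `RootSwap ε`,
  `RootSwapArc ε`, `ArcMassRatio c`, `SwapArcPositive D ρ Λ m a b`, and the absolute split of the
  residual `HalfDiscArcArrival B`, `ArcRootedBulkMass A`;
* lattice helpers: finiteness of the swap arc and of the `K`-mid-edge set (from
  `Negative.hexDomainMidEdges_finite`), monotonicity and nonnegativity of the finite sums, DOMAIN
  MONOTONICITY `domainMono` (`Λ' ⊆ Λ ⇒ Z_{Λ'} ≤ Z_Λ`), `halfDisc_subset`, `arcSum_halfDisc_le`; the one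
  trivial registered sub-goal is `massK_nonneg`.

Sources: the line card `Cruxes/MassRatio/Lines/flat-root-arc-swap.md`; the idea card
`Cruxes/MassRatio/Ideas/flat-root-arc-swap.md` (ideator 6, `IdeatorSixSketch.domainMono`);
H. Duminil-Copin, S. Smirnov, Ann. of Math. 175 (2012) (arXiv:1007.0575) for the observable.
Deliberately NOT here: the stub statements proper and the glue (`…FlatRootGlue.lean`).
-/

noncomputable section

namespace Summit.CriticalPhenomena.SAWScalingLimit.Theorems.MassRatio.FlatRoot

open Literature.Probability.LatticeModels Literature.Probability.RandomPlanarGeometry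
open Literature.Probability.RandomPlanarGeometry.SAW
open Summit.CriticalPhenomena.SAWScalingLimit.Theorems.MassRatio.Negative
open Summit.CriticalPhenomena.SAWScalingLimit.Theorems.MassRatio.Renewal (Z)
open scoped Classical

/-! ### The mass, the frame, the arc, the bulk functional, the half-disc -/

/-- The hypothesis frame of `MassRatio` (its six curried hypotheses, verbatim, as one predicate):
`0 < ρ`; flatness of `D` at `b = D.pt 1` on `B(b,ρ)`; the eventual admissibility clause (simply
connected, `a_δ, b_δ` boundary mid-edges, a SAW `a_δ → b_δ`, connected, inside `D`, ROWS clause);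
exhaustion of compacts; `δ·mid a_δ → a`; `δ·mid b_δ → b`. [folklore] -/
def Frame (D : DobrushinDomain) (ρ : ℝ) (Λ : ℝ → Finset HexVertex) (m : ℝ → ℤ)
    (a b : ℝ → Sym2 HexVertex) : Prop :=
  0 < ρ ∧
  D.carrier ∩ Metric.ball (D.pt 1) ρ = {z : ℂ | (D.pt 1).im < z.im} ∩ Metric.ball (D.pt 1) ρ ∧
  (∀ᶠ δ : ℝ in nhdsWithin 0 (Set.Ioi 0),
      hexDomainSimplyConnected (Λ δ) ∧ a δ ∈ hexDomainBoundary (Λ δ) ∧ b δ ∈ hexDomainBoundary (Λ δ) ∧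
      Nonempty (HexMidEdgeSAW (Λ δ) (a δ) (b δ)) ∧
      (hexGraph.induce ((Λ δ : Finset HexVertex) : Set HexVertex)).Preconnected ∧
      (∀ v ∈ Λ δ, (δ : ℂ) * hexCenter v ∈ D.carrier) ∧
      (∀ v : HexVertex, (δ : ℂ) * hexCenter v ∈ Metric.ball (D.pt 1) ρ → (v ∈ Λ δ ↔ m δ ≤ v.1 1))) ∧
  (∀ K : Set ℂ, IsCompact K → K ⊆ D.carrier → ∀ᶠ δ : ℝ in nhdsWithin 0 (Set.Ioi 0),
      ∀ v : HexVertex, (δ : ℂ) * hexCenter v ∈ K → v ∈ Λ δ) ∧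
  Filter.Tendsto (fun δ : ℝ => (δ : ℂ) * hexMidpoint (a δ)) (nhdsWithin 0 (Set.Ioi 0)) (nhds (D.pt 0)) ∧
  Filter.Tendsto (fun δ : ℝ => (δ : ℂ) * hexMidpoint (b δ)) (nhdsWithin 0 (Set.Ioi 0)) (nhds (D.pt 1))

/-- The SWAP ARC `S_δ`: boundary mid-edges of `Λ_δ` at scaled distance `∈ [ρ/4, ρ/2]` from
`b = D.pt 1` (by the rows clause: door edges of the flat zigzag piece; `#S_δ ≍ ρ/δ`). [folklore] -/
def swapArc (D : DobrushinDomain) (ρ : ℝ) (Λ : ℝ → Finset HexVertex) (δ : ℝ) :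
    Set (Sym2 HexVertex) :=
  {e : Sym2 HexVertex | e ∈ hexDomainBoundary (Λ δ) ∧
    ρ / 4 ≤ dist ((δ : ℂ) * hexMidpoint e) (D.pt 1) ∧ dist ((δ : ℂ) * hexMidpoint e) (D.pt 1) ≤ ρ / 2}

/-- Normalised `K`-mass from the root `r`: `M_K(r) = δ² Σ_{e ∈ E(Λ), δ·mid e ∈ K} Z_Λ(r → e)`
(the crux's left-hand side for `r = a_δ`). [folklore] -/
def massK (Λ : Finset HexVertex) (r : Sym2 HexVertex) (δ : ℝ) (K : Set ℂ) : ℝ :=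
  δ ^ 2 * ∑ᶠ e ∈ {e : Sym2 HexVertex | e ∈ hexDomainMidEdges Λ ∧ (δ : ℂ) * hexMidpoint e ∈ K},
    Z Λ r e

/-- The lattice half-disc `H_δ := {v ∈ Λ_δ : |δ·c_v − b| < 3ρ/4}` (lattice-exact with flat zigzag
bottom by the rows clause). [folklore] -/
def halfDisc (D : DobrushinDomain) (ρ : ℝ) (Λ : ℝ → Finset HexVertex) (δ : ℝ) : Finset HexVertex :=
  (Λ δ).filter fun v => dist ((δ : ℂ) * hexCenter v) (D.pt 1) < 3 * ρ / 4

/-! ### The statements of the line as predicates in the exponent -/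

/-- `MassRatio` at the exponent cut `c`: in the frame, for every compact `K ⊆ Ω` some `C` with,
eventually, `M_K(a_δ) ≤ C δ^{-c} Z_{Λ_δ}(a_δ → b_δ)` (the crux is `MassRatioAt (3/4)`). [folklore] -/
def MassRatioAt (c : ℝ) : Prop :=
  ∀ (D : DobrushinDomain) (ρ : ℝ) (Λ : ℝ → Finset HexVertex) (m : ℝ → ℤ) (a b : ℝ → Sym2 HexVertex),
    Frame D ρ Λ m a b → ∀ K : Set ℂ, IsCompact K → K ⊆ D.carrier → ∃ C : ℝ,
      ∀ᶠ δ : ℝ in nhdsWithin 0 (Set.Ioi 0),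
        massK (Λ δ) (a δ) δ K ≤ C * δ ^ (-c) * Z (Λ δ) (a δ) (b δ)

/-- `RootSwap(ε)`, POINTWISE in `a' ∈ S_δ`: the cross-ratio (root-insensitivity) inequality
`M_K(a_δ)·Z(b_δ → a') ≤ C δ^{-ε} Z(a_δ → b_δ)·M_K(a')` (stronger than the arc form). [folklore] -/
def RootSwap (ε : ℝ) : Prop :=
  ∀ (D : DobrushinDomain) (ρ : ℝ) (Λ : ℝ → Finset HexVertex) (m : ℝ → ℤ) (a b : ℝ → Sym2 HexVertex),
    Frame D ρ Λ m a b → ∀ K : Set ℂ, IsCompact K → K ⊆ D.carrier → ∃ C : ℝ,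
      ∀ᶠ δ : ℝ in nhdsWithin 0 (Set.Ioi 0), ∀ a' ∈ swapArc D ρ Λ δ,
        massK (Λ δ) (a δ) δ K * Z (Λ δ) (b δ) a' ≤
          C * δ ^ (-ε) * Z (Λ δ) (a δ) (b δ) * massK (Λ δ) a' δ K

/-- `RootSwapArc(ε)` — the root swap SUMMED over the swap arc (the registered `stub_rootSwapArc` at
one `ε`): `M_K(a_δ)·Z_{Λ_δ}(b_δ → S_δ) ≤ C δ^{-ε} Z_{Λ_δ}(a_δ → b_δ)·Σ_{a'∈S_δ} M_K(a')`. [folklore] -/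
def RootSwapArc (ε : ℝ) : Prop :=
  ∀ (D : DobrushinDomain) (ρ : ℝ) (Λ : ℝ → Finset HexVertex) (m : ℝ → ℤ) (a b : ℝ → Sym2 HexVertex),
    Frame D ρ Λ m a b → ∀ K : Set ℂ, IsCompact K → K ⊆ D.carrier → ∃ C : ℝ,
      ∀ᶠ δ : ℝ in nhdsWithin 0 (Set.Ioi 0),
        massK (Λ δ) (a δ) δ K * ∑ᶠ a' ∈ swapArc D ρ Λ δ, Z (Λ δ) (b δ) a' ≤
          C * δ ^ (-ε) * Z (Λ δ) (a δ) (b δ) * ∑ᶠ a' ∈ swapArc D ρ Λ δ, massK (Λ δ) a' δ K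

/-- `ArcMassRatio(c)` — the registered `stub_arcMassRatio` at one `c`: arc-rooted normalised bulk
mass against the far-arc arrival mass from the tame root `b_δ` inside `H_δ`,
`Σ_{a'∈S_δ} M_K(a') ≤ C δ^{-c} Σ_{a'∈S_δ} Z_{H_δ}(b_δ → a')`. [folklore] -/
def ArcMassRatio (c : ℝ) : Prop :=
  ∀ (D : DobrushinDomain) (ρ : ℝ) (Λ : ℝ → Finset HexVertex) (m : ℝ → ℤ) (a b : ℝ → Sym2 HexVertex),
    Frame D ρ Λ m a b → ∀ K : Set ℂ, IsCompact K → K ⊆ D.carrier → ∃ C : ℝ,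
      ∀ᶠ δ : ℝ in nhdsWithin 0 (Set.Ioi 0),
        ∑ᶠ a' ∈ swapArc D ρ Λ δ, massK (Λ δ) a' δ K ≤
          C * δ ^ (-c) * ∑ᶠ a' ∈ swapArc D ρ Λ δ, Z (halfDisc D ρ Λ δ) (b δ) a'

/-- `SwapArcPositive` for one datum `(D, ρ, Λ, m, a, b)` — the registered `stub_swapArcPositive`:
in the frame, eventually the arc mass `Z_{Λ_δ}(b_δ → S_δ)` is positive. [folklore] -/
def SwapArcPositive (D : DobrushinDomain) (ρ : ℝ) (Λ : ℝ → Finset HexVertex) (m : ℝ → ℤ)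
    (a b : ℝ → Sym2 HexVertex) : Prop :=
  Frame D ρ Λ m a b → ∀ᶠ δ : ℝ in nhdsWithin 0 (Set.Ioi 0),
    0 < ∑ᶠ a' ∈ swapArc D ρ Λ δ, Z (Λ δ) (b δ) a'

/-- Far-arc arrival lower bound from the tame root at exponent `B` (boundary half of the absolute
split of `ArcMassRatio`; conjectured truth `B = 1/4`). [folklore] -/
def HalfDiscArcArrival (B : ℝ) : Prop :=
  ∀ (D : DobrushinDomain) (ρ : ℝ) (Λ : ℝ → Finset HexVertex) (m : ℝ → ℤ) (a b : ℝ → Sym2 HexVertex),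
    Frame D ρ Λ m a b → ∃ c₀ : ℝ, 0 < c₀ ∧ ∀ᶠ δ : ℝ in nhdsWithin 0 (Set.Ioi 0),
      c₀ * δ ^ B ≤ ∑ᶠ a' ∈ swapArc D ρ Λ δ, Z (halfDisc D ρ Λ δ) (b δ) a'

/-- Arc-rooted normalised bulk mass upper bound at exponent `A` (bulk half of the absolute split of
`ArcMassRatio`; conjectured truth `A = 13/48`; no polynomial `A` is known rigorously). [folklore] -/
def ArcRootedBulkMass (A : ℝ) : Prop :=
  ∀ (D : DobrushinDomain) (ρ : ℝ) (Λ : ℝ → Finset HexVertex) (m : ℝ → ℤ) (a b : ℝ → Sym2 HexVertex),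
    Frame D ρ Λ m a b → ∀ K : Set ℂ, IsCompact K → K ⊆ D.carrier → ∃ C : ℝ,
      ∀ᶠ δ : ℝ in nhdsWithin 0 (Set.Ioi 0),
        ∑ᶠ a' ∈ swapArc D ρ Λ δ, massK (Λ δ) a' δ K ≤ C * δ ^ (-A)

/-! ### Lattice helpers: nonnegativity, finiteness of the edge sets, domain monotonicity -/

/-- The swap arc is a finite set of mid-edges. -/
theorem swapArc_finite (D : DobrushinDomain) (ρ : ℝ) (Λ : ℝ → Finset HexVertex) (δ : ℝ) :
    (swapArc D ρ Λ δ).Finite :=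
  ((hexDomainMidEdges_finite (Λ δ)).subset (hexDomainBoundary_subset (Λ δ))).subset fun _ he => he.1

/-- The set of `K`-mid-edges of `Λ` is finite. -/
theorem midEdgesIn_finite (Λ : Finset HexVertex) (δ : ℝ) (K : Set ℂ) :
    {e : Sym2 HexVertex | e ∈ hexDomainMidEdges Λ ∧ (δ : ℂ) * hexMidpoint e ∈ K}.Finite :=
  (hexDomainMidEdges_finite Λ).subset fun _ he => he.1

/-- Monotonicity of finite sums over a finite set of mid-edges. -/
theorem finsum_mem_mono {S : Set (Sym2 HexVertex)} (hS : S.Finite) {f g : Sym2 HexVertex → ℝ}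
    (h : ∀ e ∈ S, f e ≤ g e) : ∑ᶠ e ∈ S, f e ≤ ∑ᶠ e ∈ S, g e := by
  rw [finsum_mem_eq_finite_toFinset_sum f hS, finsum_mem_eq_finite_toFinset_sum g hS]
  exact Finset.sum_le_sum fun e he => h e (hS.mem_toFinset.1 he)

/-- Nonnegativity of such sums. -/
theorem finsum_mem_nonneg_of_finite {S : Set (Sym2 HexVertex)} (hS : S.Finite)
    {f : Sym2 HexVertex → ℝ} (h : ∀ e ∈ S, 0 ≤ f e) : 0 ≤ ∑ᶠ e ∈ S, f e := by
  rw [finsum_mem_eq_finite_toFinset_sum f hS]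
  exact Finset.sum_nonneg fun e he => h e (hS.mem_toFinset.1 he)

/-- `M_K(r) ≥ 0` (the registered trivial sub-goal of this vocabulary file). -/
theorem massK_nonneg : ∀ (Λ : Finset HexVertex) (r : Sym2 HexVertex) (δ : ℝ) (K : Set ℂ), 0 ≤ massK Λ r δ K := by
  intro Λ r δ K
  unfold massK
  exact mul_nonneg (sq_nonneg δ) (finsum_nonneg fun e => finsum_nonneg fun _ => norm_nonneg _)

/-- **Domain monotonicity** of `σ = 0` masses: the walks of `Λ' ⊆ Λ` are walks of `Λ`, so
`Z_{Λ'}(r → z) ≤ Z_Λ(r → z)` (ideator 6, `IdeatorSixSketch.domainMono`; reproduced). -/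
theorem domainMono (Λ Λ' : Finset HexVertex) (r z : Sym2 HexVertex) (hsub : Λ' ⊆ Λ) :
    Z Λ' r z ≤ Z Λ r z := by
  unfold Z
  rw [hexParafermionicObservable_zero_spin, hexParafermionicObservable_zero_spin,
    Complex.norm_real, Complex.norm_real]
  have hx : 0 ≤ hexCriticalFugacity := hexCriticalFugacity_pos_lt_one.1.le
  have h1 : 0 ≤ ∑ γ : HexMidEdgeSAW Λ' r z, hexCriticalFugacity ^ γ.length :=
    Finset.sum_nonneg fun γ _ => pow_nonneg hx _
  have h2 : 0 ≤ ∑ γ : HexMidEdgeSAW Λ r z, hexCriticalFugacity ^ γ.length :=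
    Finset.sum_nonneg fun γ _ => pow_nonneg hx _
  rw [Real.norm_of_nonneg h1, Real.norm_of_nonneg h2]
  let ι : HexMidEdgeSAW Λ' r z → HexMidEdgeSAW Λ r z := fun γ =>
    { verts := γ.verts
      subset := fun v hv => hsub (γ.subset v hv)
      nodup := γ.nodup
      isChain := γ.isChain
      head_mem := γ.head_mem
      getLast_mem := γ.getLast_mem
      eq_of_nil := γ.eq_of_nil
      edges_nodup := γ.edges_nodup
      fst_mem := by
        obtain ⟨he, v, hv, hvΛ⟩ := γ.fst_mem
        exact ⟨he, v, hv, hsub hvΛ⟩ }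
  have hι : Function.Injective ι := by
    intro γ₁ γ₂ h
    have : (ι γ₁).verts = (ι γ₂).verts := by rw [h]
    exact HexMidEdgeSAW.ext this
  have hlen : ∀ γ, (ι γ).length = γ.length := fun γ => rfl
  calc ∑ γ : HexMidEdgeSAW Λ' r z, hexCriticalFugacity ^ γ.length
      = ∑ γ : HexMidEdgeSAW Λ' r z, hexCriticalFugacity ^ (ι γ).length := by simp only [hlen]
    _ = ∑ γ ∈ (Finset.univ : Finset (HexMidEdgeSAW Λ' r z)).map ⟨ι, hι⟩,
          hexCriticalFugacity ^ γ.length := by rw [Finset.sum_map]; rfl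
    _ ≤ ∑ γ : HexMidEdgeSAW Λ r z, hexCriticalFugacity ^ γ.length :=
        Finset.sum_le_sum_of_subset_of_nonneg (Finset.subset_univ _) fun γ _ _ => pow_nonneg hx _

/-- `H_δ ⊆ Λ_δ`. -/
theorem halfDisc_subset (D : DobrushinDomain) (ρ : ℝ) (Λ : ℝ → Finset HexVertex) (δ : ℝ) :
    halfDisc D ρ Λ δ ⊆ Λ δ :=
  Finset.filter_subset _ _

/-- `Z_{H_δ} ≤ Z_{Λ_δ}` termwise on the arc, hence for the arc sums. -/
theorem arcSum_halfDisc_le (D : DobrushinDomain) (ρ : ℝ) (Λ : ℝ → Finset HexVertex) (δ : ℝ)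
    (r : Sym2 HexVertex) :
    ∑ᶠ a' ∈ swapArc D ρ Λ δ, Z (halfDisc D ρ Λ δ) r a' ≤ ∑ᶠ a' ∈ swapArc D ρ Λ δ, Z (Λ δ) r a' :=
  finsum_mem_mono (swapArc_finite D ρ Λ δ) fun _ _ => domainMono _ _ _ _ (halfDisc_subset D ρ Λ δ)

end Summit.CriticalPhenomena.SAWScalingLimit.Theorems.MassRatio.FlatRoot
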